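/-
Copyright (c) 2026 the pub-hodgecm-mathlib formalisation cell (harness21).  Prover seat hodgecm-mathlib-F0P3-p01 (g32), Track A «(D-RAM) FOUR-FRAME», unit U2H, census leaf
(ρ2b′-X) — T5b «toric level census, type RamK»: the norm-depth index `I(c) = [U_M : B_c]` when the hermitian norm has an image of INDEX TWO (M∕K♮ ramified).  2026-09-04.
-/
import Literature.NumberTheory.LocalFields.QuadraticOrderNormTwistClasses        -- ★ p857299 (LH4-p08 (g4)): the norm hom `ω ↦ ωΘω`, `Ũ`, `Ṽ_r`, `B_r` as subgroups of `Mˣ`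
import Literature.NumberTheory.LocalFields.QuadraticOrderNormIndexTwoPullback     -- (this seat) `relIndex_comap_eq_div_two_of_le` ∕ `relIndex_comap_eq_of_not_le`
import Literature.NumberTheory.LocalFields.QuadraticOrderThetaFixedUnits          -- ★ p857302 (this seat): `Ṽ_c = 𝒪_Fˣ·Ṽ′_{⌈c∕2⌉}` (`mem_order_iff_exists_fixed_fixed_mul_of_theta_fixed`)
import Literature.NumberTheory.LocalFields.WildQuadraticDatumNormFibreValuesAbove  -- ★ p856861: `exists_mul_map_eq_of_approx` (norms above the conductor), `exists_mul_map_eq_mul_iff`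
import Literature.NumberTheory.LocalFields.WildQuadraticDatumNonNormUnitLevel      -- ★ `exists_fixed_unit_not_norm_of_level_pow` (a non-norm below the conductor)
import Literature.NumberTheory.LocalFields.ValuedCompleteIsAdicComplete            -- ★ `isAdicComplete_valuedInteger_of_completeSpace`
import HarnessLib

/-!
# The norm-depth index with a norm image of index two: `[U_M : B_c] = [Ũ : Ṽ_c] ∕ 2` for `c ≥ 2d − 1` and `= [Ũ : Ṽ_c]` for `c ≤ 2d − 2`
(Serre, *Local Fields* Ch. V §3 Cor. 3 (norm index two, conductor `d`); Flicker 1998 p. 84 (order unit indices))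

Topic `NumberTheory/LocalFields`; namespace `Literature.NumberTheory.LocalFields.QuadraticOrder`.  THEOREMS ONLY (no definition, no instance, no notation, no named fact, no
`sorry`); kernel lane `--supports stmt-HodgeConjecture-24833` (count-neutral).  Cell `pub/hodgecm-mathlib` (D-0151), crux H413, Track A, unit U2H, census leaf (ρ2b′-X): TYPE RamK
of the toric census (hodgecm-mathlib-F0P3-p01 (g32) T5b memo §1–§2, sheet v4 `idxRK`): the depth histogram of the hermitian norms `ωΘω` of the units of `M` against the
`E`-orders is `#{ω̄ : depth ≥ c} = |G_j| ∕ I(c)` with **`I(c) := [U_M : B_c]`**, `B_c = {ω : |ω| = 1, |ωΘω − ρ(ωΘω)| ≤ |ϖ|^c}` (★ p857299's norm-depth subgroups).  LH4-p08 (g4)'s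
★ `relIndex_normDepth_eq` treats the case where the norm is ONTO the `Θ`-fixed units (M∕K♮ unramified, type U); HERE `M∕K♮` is a RAMIFIED quadratic datum `(Θ, ϖ, d, t)`, the
norm image `N(U_M)` has index TWO in `Ũ` (★ dichotomy + ★ non-norm), and
* §1 `relIndex_eq_two_of_dichotomy` — commutative-group letter: `c ∈ A ∖ H`, `A ⊆ H ∪ c⁻¹H` ⇒ `H.relIndex A = 2`;
* §2 `map_normHom_units_relIndex_eq_two` — `[Ũ : N(U_M)] = 2` for a ramified datum `(M, Θ, ϖ, d, t)` over a complete field with finite residue field;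
* §3 THE THRESHOLD: `Ṽ_c ≤ N(U_M)` for `2d ≤ c + 1` (`thetaFixedDepth_le_map_normHom_of_le`: ★ p857302 `Ṽ_c = 𝒪_Fˣ·Ṽ′_{⌈c∕2⌉}`, ★ norms above the conductor, and the
  base-unit token `𝒪_Fˣ ⊆ N` of ★ `QuadraticDatumNormsOfDoublyFixedUnits`), `Ṽ_c ≰ N(U_M)` for `c + 2 ≤ 2d` (`not_thetaFixedDepth_le_map_normHom_of_le`: ★ non-norm at level `⌈c∕2⌉ ≤ d−1`);
* §4 **`relIndex_normDepth_eq_ite_of_index_two`** — `[U_M : B_c] = if 2d ≤ c+1 then [Ũ : Ṽ_c] ∕ 2 else [Ũ : Ṽ_c]` (pull-back bookkeeping `QuadraticOrderNormIndexTwoPullback`).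
The remaining type-RamK number `J(c) = [Ũ : Ṽ_c] = (q+1)q^{⌈c∕2⌉−1}` (Flicker Prop. 7 on the unramified third field) is a separate file.
HONEST LABEL: HC_CM is proved only modulo the 7 printed citations (2 remaining named inputs: hLiu418 = stmt-HodgeConjecture-24832, h413 = stmt-HodgeConjecture-24833) until rung 0
closes; unconditional local algebra, count-neutral.

## References
* [Serre1979] J.-P. Serre, *Local Fields*, GTM 67 (1979): Ch. V §3 Cor. 3 (norm subgroup of index two, conductor), Ch. V §1 (unit filtrations).
* [Flicker1998UnitaryFL] Y. Z. Flicker, *Elementary proof of the fundamental lemma for a unitary group*, Canad. J. Math. 50 (1998): p. 84 (unit indices of the orders).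
-/

set_option autoImplicit false

open WithZero IsLocalRing
open scoped Valued
open Literature.NumberTheory.Automorphic.UnitaryThreeFourFrame
open Literature.NumberTheory.LocalFields.WildQuadraticDatum
open Literature.NumberTheory.LocalFields (isAdicComplete_valuedInteger_of_completeSpace)

namespace Literature.NumberTheory.LocalFields.QuadraticOrder

/-! ## §1 Index two from a dichotomy (commutative groups) -/

section Dichotomy

variable {G : Type*} [CommGroup G] {H A : Subgroup G}

/-- **`[A : H ⊓ A] = 2` FROM A DICHOTOMY**: an element `c ∈ A ∖ H` and `∀ a ∈ A, a ∈ H ∨ c·a ∈ H` (for `H ≤ A` this is `[A : H] = 2`). [cite: Serre1979, Ch. V §3 Cor. 3] -/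
theorem relIndex_eq_two_of_dichotomy {c : G} (hcA : c ∈ A) (hcH : c ∉ H) (hdich : ∀ a ∈ A, a ∈ H ∨ c * a ∈ H) : H.relIndex A = 2 := by
  rw [Subgroup.relIndex, Subgroup.index_eq_two_iff]
  refine ⟨⟨c, hcA⟩, fun b => ?_⟩
  simp only [Subgroup.mem_subgroupOf, Subgroup.coe_mul]
  rcases hdich b b.2 with hb | hb
  · refine Or.inr ⟨hb, fun hbc => hcH ?_⟩
    have := H.mul_mem (H.inv_mem hb) hbc
    rwa [inv_mul_cancel_left] at this
  · refine Or.inl ⟨by rwa [mul_comm] at hb, fun hb' => hcH ?_⟩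
    have := H.mul_mem hb (H.inv_mem hb')
    rwa [mul_inv_cancel_right] at this

end Dichotomy

/-! ## §2 The norm image has index two in the `Θ`-fixed units (ramified datum `(M, Θ, ϖ, d, t)`) -/

section IndexTwo

variable {K : Type} [Field K] [Valued K ℤᵐ⁰] {ρ Θ : K →+* K}

/-- Norm witnesses are units: `ωΘω = z` with `|z| = 1` forces `|ω| = 1` (`Θ` isometric). [cite: Serre1979, Ch. V §1] -/
theorem v_eq_one_of_mul_map_eq (hvΘ : ∀ x, Valued.v (Θ x) = Valued.v x) {ω z : K} (hz : Valued.v z = 1) (h : ω * Θ ω = z) : Valued.v ω = 1 := by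
  have h2 : Valued.v ω * Valued.v ω = 1 := by
    have := congrArg Valued.v h
    rwa [map_mul, hvΘ, hz] at this
  rcases eq_or_ne (Valued.v ω) 0 with h0 | h0
  · rw [h0, zero_mul] at h2; exact absurd h2 zero_ne_one
  · have := congrArg log h2
    rw [log_mul h0 h0, log_one] at this
    rw [← exp_log h0, ← exp_zero]; congr 1; omega

/-- **MEMBERSHIP IN THE NORM IMAGE**: for the norm hom `N = MonoidHom.id · Units.map Θ` and `U = {|ω| = 1}`, a unit `z ∈ Mˣ` lies in `N(U)` iff `z = ωΘω` for some `ω ∈ M`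
(automatically a unit). [cite: Serre1979, Ch. V §1] -/
theorem mem_map_normHom_iff (hvΘ : ∀ x, Valued.v (Θ x) = Valued.v x) {U : Subgroup Kˣ} (hU : ∀ u, u ∈ U ↔ Valued.v (u : K) = 1)
    {z : Kˣ} (hz : Valued.v (z : K) = 1) :
    z ∈ U.map (MonoidHom.id Kˣ * Units.map (Θ : K →* K)) ↔ ∃ ω : K, ω * Θ ω = z := by
  constructor
  · rintro ⟨ω, -, rfl⟩
    exact ⟨ω, (coe_normHom ω).symm⟩
  · rintro ⟨ω, hω⟩
    have hω1 : Valued.v ω = 1 := v_eq_one_of_mul_map_eq hvΘ hz hω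
    have hω0 : ω ≠ 0 := (Valuation.ne_zero_iff _).1 (by rw [hω1]; exact one_ne_zero)
    refine ⟨Units.mk0 ω hω0, (hU _).2 (by rw [Units.val_mk0]; exact hω1), Units.ext ?_⟩
    rw [coe_normHom, Units.val_mk0]; exact hω

/-- **`[Ũ : N(U_M)] = 2` FOR A RAMIFIED QUADRATIC DATUM `(M, Θ, ϖ, d, t)`** over a complete field with finite residue field: the ★ unit-norm dichotomy gives `≤ 2`, a ★ non-norm
`Θ`-fixed unit (level `0 ≤ d − 1`) gives `≠ 1`, and norm classes multiply. [cite: Serre1979, Ch. V §3 Cor. 3] -/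
theorem map_normHom_units_relIndex_eq_two [CompleteSpace K] [Finite 𝓀[K]] {ϖ : K} {d t : ℕ} (hD : IsRamifiedQuadraticDatum Θ ϖ d t)
    {U Ut : Subgroup Kˣ} (hU : ∀ u, u ∈ U ↔ Valued.v (u : K) = 1) (hUt : ∀ z, z ∈ Ut ↔ Θ (z : K) = z ∧ Valued.v (z : K) = 1) :
    (U.map (MonoidHom.id Kˣ * Units.map (Θ : K →* K))).relIndex Ut = 2 := by
  have hΘΘ := hD.1; have hvΘ := hD.2.1
  haveI : IsAdicComplete 𝓂[K] 𝒪[K] := isAdicComplete_valuedInteger_of_completeSpace hD.2.2.1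
  obtain ⟨c₀, hΘc₀, hc₀, hdich⟩ := exists_unit_norm_dichotomy_of_isRamifiedQuadraticDatum Θ ϖ d t hD
  obtain ⟨u₀, hΘu₀, hu₀, -, hu₀N⟩ := exists_fixed_unit_not_norm_of_level_pow Θ ϖ d t hD (n := 0) (by have := hD.2.2.2.2.2.1; omega)
  have hu₀0 : (u₀ : K) ≠ 0 := (Valuation.ne_zero_iff _).1 (by rw [hu₀]; exact one_ne_zero)
  refine relIndex_eq_two_of_dichotomy (c := Units.mk0 u₀ hu₀0) ((hUt _).2 ⟨by rw [Units.val_mk0]; exact hΘu₀, by rw [Units.val_mk0]; exact hu₀⟩)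
    (fun hmem => hu₀N ((mem_map_normHom_iff hvΘ hU (by rw [Units.val_mk0]; exact hu₀)).1 hmem |>.imp fun ω hω => by rw [Units.val_mk0] at hω; exact hω)) ?_
  intro a ha
  obtain ⟨hΘa, ha1⟩ := (hUt a).1 ha
  by_cases haN : ∃ ω : K, ω * Θ ω = a
  · exact Or.inl ((mem_map_normHom_iff hvΘ hU ha1).2 haN)
  · right
    have hprod : ∃ ω : K, ω * Θ ω = u₀ * a :=
      (exists_mul_map_eq_mul_iff hΘc₀ hc₀ hdich hΘu₀ hu₀ hΘa ha1).2 ⟨fun h => absurd h hu₀N, fun h => absurd h haN⟩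
    exact (mem_map_normHom_iff hvΘ hU (by rw [Units.val_mul, Units.val_mk0, map_mul, hu₀, ha1, mul_one])).2
      (by rw [Units.val_mul, Units.val_mk0]; exact hprod)

end IndexTwo

/-! ## §3 The threshold: `Ṽ_c ≤ N(U_M)` exactly when `2d ≤ c + 1` -/

section Threshold

variable {K : Type} [Field K] [Valued K ℤᵐ⁰] {ρ Θ : K →+* K} {α : K}

/-- A `Θ`-fixed unit with `|z − ρz| ≤ exp(−c)` (`α − ρα` a unit) is `f·w` with `f` doubly fixed and `w` `Θ`-fixed, `|w − 1| ≤ exp(−2⌈c∕2⌉)` — ★ p857302 read on the depth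
letter. [cite: Serre1979, Ch. V §1] -/
theorem exists_fixed_fixed_mul_of_depth (hρρ : ∀ x, ρ (ρ x) = x) (hvρ : ∀ x, Valued.v (ρ x) = Valued.v x) (hα1 : Valued.v α ≤ 1) (hδ : Valued.v (α - ρ α) = 1)
    (hΘΘ : ∀ x, Θ (Θ x) = x) (hΘρ : ∀ x, Θ (ρ x) = ρ (Θ x)) (hvΘ : ∀ x, Valued.v (Θ x) = Valued.v x) (hfix : ∀ c : K, Θ c = c → c ≠ 0 → Even (log (Valued.v c)))
    {ϖ : K} (hρϖ : ρ ϖ = ϖ) (hϖ : Valued.v ϖ = exp (-1 : ℤ)) (hΘϖ : Θ ϖ ≠ ϖ) (c : ℕ) {z : K} (hΘz : Θ z = z) (hz1 : Valued.v z = 1)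
    (hzc : Valued.v (z - ρ z) ≤ exp (-(c : ℤ))) :
    ∃ f w : K, ρ f = f ∧ Θ f = f ∧ Valued.v f = 1 ∧ Θ w = w ∧ Valued.v (w - 1) ≤ exp (-(2 * (((c : ℤ) + 1) / 2))) ∧ z = f * w := by
  have hα : ρ α ≠ α := fun h => by rw [h, sub_self, map_zero] at hδ; exact zero_ne_one hδ
  have hint := v_bCoord_le_one_of_v_sub_map_eq_one hvρ hδ
  refine (mem_order_iff_exists_fixed_fixed_mul_of_theta_fixed hρρ hvρ hα hα1 hint hΘΘ hΘρ hvΘ hfix hρϖ hϖ hΘϖ c hΘz hz1).1 ⟨hz1.le, ?_⟩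
  rw [map_mul, map_pow, hϖ, hδ, mul_one, ← exp_nsmul]; simpa using hzc

/-- **ABOVE THE THRESHOLD (`2d ≤ c + 1`) EVERY ELEMENT OF `Ṽ_c` IS A NORM**: `z = f·w`, `w ≡ 1 (ϖ^{2⌈c∕2⌉})` with `2⌈c∕2⌉ ≥ 2d − 1` is a norm (★ norms above the conductor on the
datum (M, Θ, ϖ, d, t)), and the doubly fixed unit `f` is a norm by the base-unit token `hFN` (★ `QuadraticDatumNormsOfDoublyFixedUnits`). [cite: Serre1979, Ch. V §3 Cor. 3] -/
theorem exists_mul_map_eq_of_depth_of_le [CompleteSpace K] (hρρ : ∀ x, ρ (ρ x) = x) (hvρ : ∀ x, Valued.v (ρ x) = Valued.v x) (hα1 : Valued.v α ≤ 1) (hδ : Valued.v (α - ρ α) = 1)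
    (hΘρ : ∀ x, Θ (ρ x) = ρ (Θ x)) {ϖ : K} {d t : ℕ} (hD : IsRamifiedQuadraticDatum Θ ϖ d t) (hρϖ : ρ ϖ = ϖ)
    (hFN : ∀ f : K, ρ f = f → Θ f = f → Valued.v f = 1 → ∃ x : K, x * Θ x = f)
    {c : ℕ} (hc : 2 * d ≤ c + 1) {z : K} (hΘz : Θ z = z) (hz1 : Valued.v z = 1) (hzc : Valued.v (z - ρ z) ≤ exp (-(c : ℤ))) :
    ∃ ω : K, ω * Θ ω = z := by
  have hΘΘ := hD.1; have hvΘ := hD.2.1; have hϖ := hD.2.2.1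
  have hfix : ∀ c : K, Θ c = c → c ≠ 0 → Even (log (Valued.v c)) := fun c hc hc0 => by
    obtain ⟨n, hn⟩ := hD.2.2.2.1 c hc hc0
    rw [hn, log_exp]; exact even_two_mul n
  have hΘϖ : Θ ϖ ≠ ϖ := fun h => by
    have := hD.2.2.2.2.1
    rw [h, sub_self, map_zero] at this
    exact (pow_ne_zero _ ((Valuation.ne_zero_iff _).2 ((Valuation.ne_zero_iff _).1 (by rw [hϖ]; exact exp_ne_zero)))) this.symm
  obtain ⟨f, w, hρf, hΘf, hf1, hΘw, hw, rfl⟩ := exists_fixed_fixed_mul_of_depth hρρ hvρ hα1 hδ hΘΘ hΘρ hvΘ hfix hρϖ hϖ hΘϖ c hΘz hz1 hzc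
  obtain ⟨x, hx⟩ := hFN f hρf hΘf hf1
  -- `w` is a norm: `|1·Θ1 − w| ≤ |ϖ^{2⌈c/2⌉}|` with `2⌈c/2⌉ ≥ 2d − 1`
  obtain ⟨y, hy⟩ := exists_mul_map_eq_of_approx hD hΘw (z := 1) (by rw [map_one]) (n := 2 * ((c + 1) / 2)) (by omega)
    (by rw [map_one, one_mul, Valuation.map_sub_swap, map_pow, hϖ, ← exp_nsmul]; simpa using hw)
  exact ⟨x * y, by rw [map_mul, mul_mul_mul_comm, hx, hy]⟩

/-- **BELOW THE THRESHOLD (`c + 2 ≤ 2d`) SOME ELEMENT OF `Ṽ_c` IS NOT A NORM**: the ★ non-norm `Θ`-fixed unit at level `⌈c∕2⌉ ≤ d − 1` has `|u − 1| ≤ |ϖ|^{2⌈c∕2⌉} ≤ |ϖ|^c`, hence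
`ρ`-depth `≥ c`. [cite: Serre1979, Ch. V §3 Cor. 3] -/
theorem exists_depth_not_norm_of_le [CompleteSpace K] [Finite 𝓀[K]] (hvρ : ∀ x, Valued.v (ρ x) = Valued.v x)
    {ϖ : K} {d t : ℕ} (hD : IsRamifiedQuadraticDatum Θ ϖ d t) {c : ℕ} (hc : c + 2 ≤ 2 * d) :
    ∃ u : K, Θ u = u ∧ Valued.v u = 1 ∧ Valued.v (u - ρ u) ≤ exp (-(c : ℤ)) ∧ ¬ ∃ ω : K, ω * Θ ω = u := by
  have hϖ := hD.2.2.1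
  haveI : IsAdicComplete 𝓂[K] 𝒪[K] := isAdicComplete_valuedInteger_of_completeSpace hϖ
  obtain ⟨u, hΘu, hu1, hu, huN⟩ := exists_fixed_unit_not_norm_of_level_pow Θ ϖ d t hD (n := (c + 1) / 2) (by omega)
  refine ⟨u, hΘu, hu1, ?_, huN⟩
  have hu' : Valued.v (u - 1) ≤ exp (-(c : ℤ)) := hu.trans (by
    rw [map_pow, hϖ, ← exp_nsmul, exp_le_exp, smul_neg, nsmul_eq_mul, mul_one]; omega)
  have h1 : u - ρ u = (u - 1) - ρ (u - 1) := by rw [map_sub, map_one]; ring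
  rw [h1]
  exact (Valuation.map_sub _ _ _).trans (max_le hu' (by rw [hvρ]; exact hu'))

end Threshold

/-! ## §4 The index `[U_M : B_c]` -/

section Index

variable {K : Type} [Field K] [Valued K ℤᵐ⁰] {ρ Θ : K →+* K} {α : K}

/-- **THE NORM-DEPTH INDEX WITH AN IMAGE OF INDEX TWO** (type RamK ∕ ramified `M∕K♮`): for `U = {|ω| = 1}`, `Ũ = {Θz = z, |z| = 1}`, `Ṽ_c = Ũ ∩ {|z − ρz| ≤ exp(−c)}`,
`B_c = {|ω| = 1, |ωΘω − ρ(ωΘω)| ≤ exp(−c)}` (★ p857299's subgroups), a ramified datum `(M, Θ, ϖ, d, t)` over a complete field with finite residue field, `M∕E` unramified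
(`|α − ρα| = 1`), `ρϖ = ϖ`, `Θρ = ρΘ`, and the base-unit token `𝒪_Fˣ ⊆ N`:
**`[U : B_c] = [Ũ : Ṽ_c] ∕ 2` if `2d ≤ c + 1`, and `= [Ũ : Ṽ_c]` if `c + 2 ≤ 2d`.** [cite: Serre1979, Ch. V §3 Cor. 3] [cite: Flicker1998UnitaryFL, p. 84] -/
theorem relIndex_normDepth_eq_ite_of_index_two [CompleteSpace K] [Finite 𝓀[K]]
    (hρρ : ∀ x, ρ (ρ x) = x) (hvρ : ∀ x, Valued.v (ρ x) = Valued.v x) (hα1 : Valued.v α ≤ 1) (hδ : Valued.v (α - ρ α) = 1)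
    (hΘρ : ∀ x, Θ (ρ x) = ρ (Θ x)) {ϖ : K} {d t : ℕ} (hD : IsRamifiedQuadraticDatum Θ ϖ d t) (hρϖ : ρ ϖ = ϖ)
    (hFN : ∀ f : K, ρ f = f → Θ f = f → Valued.v f = 1 → ∃ x : K, x * Θ x = f)
    (c : ℕ) (U Ut Vt B : Subgroup Kˣ) (hU : ∀ u, u ∈ U ↔ Valued.v (u : K) = 1)
    (hUt : ∀ z, z ∈ Ut ↔ Θ (z : K) = z ∧ Valued.v (z : K) = 1)
    (hVt : ∀ z, z ∈ Vt ↔ Θ (z : K) = z ∧ Valued.v (z : K) = 1 ∧ Valued.v ((z : K) - ρ z) ≤ exp (-(c : ℤ)))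
    (hB : ∀ ω, ω ∈ B ↔ Valued.v (ω : K) = 1 ∧ Valued.v ((ω : K) * Θ ω - ρ ((ω : K) * Θ ω)) ≤ exp (-(c : ℤ))) :
    B.relIndex U = if 2 * d ≤ c + 1 then Vt.relIndex Ut / 2 else Vt.relIndex Ut := by
  have hΘΘ := hD.1; have hvΘ := hD.2.1
  set N : Kˣ →* Kˣ := MonoidHom.id Kˣ * Units.map (Θ : K →* K) with hN
  have hNval : ∀ ω : Kˣ, ((N ω : Kˣ) : K) = (ω : K) * Θ ω := fun ω => coe_normHom ω
  have hNΘ : ∀ ω : Kˣ, Θ (((N ω : Kˣ) : K)) = ((N ω : Kˣ) : K) := fun ω => by rw [hNval, map_mul, hΘΘ, mul_comm]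
  have hN1 : ∀ {ω : Kˣ}, Valued.v (ω : K) = 1 → Valued.v (((N ω : Kˣ) : K)) = 1 := fun hω => by rw [hNval, map_mul, hvΘ, hω, mul_one]
  -- `B = N⁻¹ Ṽ ⊓ U`
  have hBeq : B = (Vt.comap N) ⊓ U := by
    ext ω
    rw [hB, Subgroup.mem_inf, Subgroup.mem_comap, hVt, hU]
    constructor
    · rintro ⟨h1, h2⟩
      exact ⟨⟨hNΘ ω, hN1 h1, by rw [hNval]; exact h2⟩, h1⟩
    · rintro ⟨⟨-, -, h2⟩, h1⟩
      rw [hNval] at h2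
      exact ⟨h1, h2⟩
  -- `N(U) ≤ Ũ` with index `2`, `Ṽ ≤ Ũ`
  have hle : U.map N ≤ Ut := by
    rintro _ ⟨ω, hω, rfl⟩
    exact (hUt _).2 ⟨hNΘ ω, hN1 ((hU ω).1 hω)⟩
  have h2 : (U.map N).relIndex Ut = 2 := map_normHom_units_relIndex_eq_two hD hU hUt
  have hVA : Vt ≤ Ut := fun z hz => (hUt z).2 ⟨((hVt z).1 hz).1, ((hVt z).1 hz).2.1⟩
  rw [hBeq, Subgroup.inf_relIndex_right]
  split_ifs with hc
  · -- above the threshold: `Ṽ ≤ N(U)`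
    have hV : Vt ≤ U.map N := by
      intro z hz
      obtain ⟨hΘz, hz1, hzc⟩ := (hVt z).1 hz
      exact (mem_map_normHom_iff hvΘ hU hz1).2 (exists_mul_map_eq_of_depth_of_le hρρ hvρ hα1 hδ hΘρ hD hρϖ hFN hc hΘz hz1 hzc)
    exact (relIndex_comap_eq_div_two_of_le N hle h2 hV).1
  · -- below the threshold: `Ṽ ≰ N(U)`
    have hV : ¬ Vt ≤ U.map N := by
      intro hV
      obtain ⟨u, hΘu, hu1, hu, huN⟩ := exists_depth_not_norm_of_le (ρ := ρ) hvρ hD (c := c) (by omega)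
      have hu0 : u ≠ 0 := (Valuation.ne_zero_iff _).1 (by rw [hu1]; exact one_ne_zero)
      have hmem : Units.mk0 u hu0 ∈ Vt := (hVt _).2 ⟨by rw [Units.val_mk0]; exact hΘu, by rw [Units.val_mk0]; exact hu1, by rw [Units.val_mk0]; exact hu⟩
      exact huN ((mem_map_normHom_iff hvΘ hU (by rw [Units.val_mk0]; exact hu1)).1 (hV hmem) |>.imp fun ω hω => by rw [Units.val_mk0] at hω; exact hω)
    exact relIndex_comap_eq_of_not_le N hle h2 hVA hV

end Index

end Literature.NumberTheory.LocalFields.QuadraticOrder
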